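import Literature.NumberTheory.ConnesConsani2021.TraceRemainderEpsilon
import Literature.NumberTheory.LFunctions.ProlateParity
import Mathlib.MeasureTheory.Measure.Lebesgue.Integral
import Mathlib.MeasureTheory.Group.Integral
import HarnessLib

/-!
# Connes–Consani 2021, Thm. 4.7 (sonine0) / Prop. 4.5 (i): the terms of `ε` as real truncated
# scaling coefficients — `⟨ξ_n | ϑ(ρ⁻¹)ψ_n⟩ = 2ρ^{1/2}∫_{ρ⁻¹}^1 ξ(t)η̃(ρt)dt` (bridge, PROVED)

RH-FREE corpus literature (label, line 1): change of variables / parity bookkeeping identifying the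
`𝓕`-based complex term `epsTerm` of `ArchimedeanTraceFormula.lean` (seat t4: the `n`-th term of
(sonine0), `λ(1−λ²)⁻¹⟨ξ|ϑ(e^{−y})Pζ⟩` written with `scalingCoeff` and `prolateCutFourier`) with the
real one-variable expression `(2λ/(1−λ²))·e^{y/2}∫_{e^{−y}}^1 ψ(t) η̃(e^{y}t) dt` in the vocabulary
of `SeriesRemainderBounds.lean` (seat t6: `cosTransform`) and of the Lemma 5.2 file
`ScalingCoeffBoundaryTerms.lean` (`exists_contDiff_truncScalingCoeff`: `C²` regularity in `y ≥ 0`).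
Nothing in this file mentions `ζ`, the critical strip or RH, and nothing here bears on the truth of
RH.  bears_on (cell rh-crit, corpus C1): apex input (B) «density of `E`» — route
«ConnesConsaniSemilocal» item K0 `DensityRegular` (the series there is literally
`Σ'_n epsTerm (ψ n) x`, `epsTerm_eq_routeTerm`).

Source: A. Connes, C. Consani, *Weil positivity and trace formula, the archimedean place*, Selecta
Math. (N.S.) 27 (2021) 77 = arXiv:2006.13771 [bib `ConnesConsani2021`]: Prop. 4.5 (i) (arXiv
Prop. 25, p0016:L50: `ψ_n = Pζ_n`, `ζ_n = 𝔽_{e_ℝ}ξ_n` real and even), Thm. 4.7 eq. (sonine0)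
(p0018:L37–40) and the first display of the proof of Lemma 5.4 (arXiv Lemma 31, p0020:L80–84:
"`⟨ξ_n | ϑ(ρ⁻¹)ζ_n⟩ = ρ^{1/2}∫_{ρ⁻¹}^1 ξ_n(x)ζ_n(ρx)dx`" for `ρ ≥ 1`, the integrand vanishing for
`|x| < ρ⁻¹` because `Pζ_n` is cut off to `|v| ≥ 1`, and the two half-lines contributing equally by
parity — CC's inner product (eq. (8) p. 7) is `½∫_ℝ` on even functions, whence their missing `2`).

What is here (all proved, no named fact; the identification `𝓕(φ) = cosTransform φ`,
`Pζ = 1_{|v| ≥ 1}·η̃` for `φ` real, even, cut off and continuous on `[−1,1]` is seat t5's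
`fourier_ofReal_eq_cosTransform` / `prolateCutFourier_eq_ofReal` in `TraceRemainderEpsilon.lean`,
imported):
* `scalingCoeff_prolateCutFourier_neg` — for `y ≥ 0`:
  `⟨φ | ϑ(e^{−y}) Pζ⟩ = 2e^{y/2}∫_{e^{−y}}^1 φ(t)η̃(e^{y}t)dt`;
* `epsTerm_eq_ofReal` — `epsTerm φ y = (2λ/(1−λ²))·e^{y/2}∫_{e^{−y}}^1 φ(t)η̃(e^{y}t)dt` (real), and
  its specialisation `epsTerm_eq_ofReal_of_isProlateFunction` to the tree's prolate functions
  (`IsProlateFunction 1 m φ`: even by `IsProlateFunction.even`, cut off, continuous on `[−1,1]`);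
* `epsTerm_eq_routeTerm` — the route's inline spelling of the term is `epsTerm` (by `rfl`).

WHAT THIS IS NOT: no convergence of the series, no regularity of `ε`, no value of `λ(n)`; those are
`SeriesRemainderBounds.lean` (App. F), `ScalingCoeffBoundaryTerms.lean` (Lemma 5.2) and §5.
-/

noncomputable section

open Real MeasureTheory Set Filter intervalIntegral
open scoped FourierTransform ComplexConjugate

namespace Literature.NumberTheory.ConnesConsani2021

open Literature.NumberTheory.LFunctions

variable {φ : ℝ → ℝ}

/-- The cosine transform is even in `y`. [cite: ConnesConsani2021, Prop. 4.5 (i) §4 p. 16] -/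
theorem cosTransform_neg_arg (φ : ℝ → ℝ) (y : ℝ) : cosTransform φ (-y) = cosTransform φ y := by
  simp only [cosTransform, mul_neg, Real.cos_neg]

/-! ## The matrix coefficient `⟨φ | ϑ(e^{−y}) Pζ⟩` as a real integral over `[e^{−y}, 1]` -/

/-- **The term of (sonine0) as a real truncated scaling coefficient** (proof of Lemma 5.4, first
display: `⟨ξ_n|ϑ(ρ⁻¹)ζ_n⟩ = ρ^{1/2}∫_{ρ⁻¹}^1ξ_n(x)ζ_n(ρx)dx`, `ρ = e^{y} ≥ 1`; in Mathlib's
`∫_ℝ ξ̄η` the two half-lines give the factor `2`): for `φ` real, even, cut off to `[−1,1]`, integrable there,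
and `y ≥ 0`,
`scalingCoeff φ (Pζ) (−y) = 2e^{y/2}∫_{e^{−y}}^1 φ(t) η̃(e^{y}t) dt`.
[cite: ConnesConsani2021, Lemma 5.4 proof §5 p. 20 (arXiv Lemma 31, chunk p0020:L80–84); Thm. 4.7 eq. (sonine0) §4 p. 18] -/
theorem scalingCoeff_prolateCutFourier_neg (heven : ∀ x, φ (-x) = φ x)
    (hsupp : ∀ x, 1 < |x| → φ x = 0) (hcont : ContinuousOn φ (Icc (-1) 1)) {y : ℝ}
    (hy : 0 ≤ y) :
    scalingCoeff (fun v ↦ (φ v : ℂ)) (prolateCutFourier φ) (-y) =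
      ((2 * (Real.exp (y / 2) *
        ∫ t in Real.exp (-y)..1, φ t * cosTransform φ (Real.exp y * t)) : ℝ) : ℂ) := by
  -- Step 1: the integrand is real
  set c : ℝ → ℝ := fun u ↦ if 1 ≤ |u| then cosTransform φ u else 0 with hc
  have hcut : ∀ u, prolateCutFourier φ u = (c u : ℂ) := fun u ↦
    prolateCutFourier_eq_ofReal heven hsupp hcont u
  have h1 : scalingCoeff (fun v ↦ (φ v : ℂ)) (prolateCutFourier φ) (-y) =
      ((∫ v, Real.exp (y / 2) * (φ v * c (Real.exp y * v)) : ℝ) : ℂ) := by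
    rw [scalingCoeff, ← integral_complex_ofReal]
    refine integral_congr_ae (Eventually.of_forall fun v ↦ ?_)
    simp only [neg_neg, hcut, Complex.conj_ofReal]
    push_cast
    ring
  rw [h1, MeasureTheory.integral_const_mul]
  -- Step 2: the real integrand `H v = φ v * c (e^y v)` is even, so `∫ H = 2 ∫_{Ioi 0} H`
  set H : ℝ → ℝ := fun v ↦ φ v * c (Real.exp y * v) with hH
  have hc_even : ∀ u, c (-u) = c u := fun u ↦ by simp only [hc, abs_neg, cosTransform_neg_arg]
  have hH_even : ∀ v, H (-v) = H v := fun v ↦ by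
    simp only [hH, heven, mul_neg, hc_even]
  have hH_abs : ∀ v, H |v| = H v := fun v ↦ by
    rcases le_or_gt 0 v with h | h
    · rw [abs_of_nonneg h]
    · rw [abs_of_neg h, hH_even]
  have h2 : ∫ v, H v = 2 * ∫ v in Ioi 0, H v := by
    rw [← integral_comp_abs]
    simp only [hH_abs]
  change ((Real.exp (y / 2) * ∫ v, H v : ℝ) : ℂ) = _
  rw [h2]
  -- Step 3: on `(0, ∞)` the integrand is `1_{[e^{−y}, 1]} · φ(t) η̃(e^y t)`
  have hexp : 0 < Real.exp (-y) := Real.exp_pos _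
  have hle : Real.exp (-y) ≤ 1 := by
    rw [Real.exp_le_one_iff]; linarith
  have h3 : ∫ v in Ioi 0, H v =
      ∫ v in Ioi 0, (Icc (Real.exp (-y)) 1).indicator
        (fun t ↦ φ t * cosTransform φ (Real.exp y * t)) v := by
    refine setIntegral_congr_fun measurableSet_Ioi fun v (hv : 0 < v) ↦ ?_
    by_cases hv1 : Real.exp (-y) ≤ v
    · by_cases hv2 : v ≤ 1
      · have hin : v ∈ Icc (Real.exp (-y)) 1 := ⟨hv1, hv2⟩
        have habs : 1 ≤ |Real.exp y * v| := by
          rw [abs_of_pos (by positivity)]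
          have := mul_le_mul_of_nonneg_left hv1 (Real.exp_pos y).le
          rwa [← Real.exp_add, add_neg_cancel, Real.exp_zero] at this
        simp only [hH, hc, indicator_of_mem hin, if_pos habs]
      · have hout : v ∉ Icc (Real.exp (-y)) 1 := fun h ↦ hv2 h.2
        have hφ0 : φ v = 0 := hsupp v (by rw [abs_of_pos hv]; exact not_le.1 hv2)
        simp only [hH, indicator_of_notMem hout, hφ0, zero_mul]
    · have hout : v ∉ Icc (Real.exp (-y)) 1 := fun h ↦ hv1 h.1
      have habs : ¬ 1 ≤ |Real.exp y * v| := by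
        rw [abs_of_pos (by positivity), not_le]
        have := mul_lt_mul_of_pos_left (not_le.1 hv1) (Real.exp_pos y)
        rwa [← Real.exp_add, add_neg_cancel, Real.exp_zero] at this
      simp only [hH, hc, indicator_of_notMem hout, if_neg habs, mul_zero]
  rw [h3, setIntegral_indicator measurableSet_Icc,
    show Ioi (0 : ℝ) ∩ Icc (Real.exp (-y)) 1 = Icc (Real.exp (-y)) 1 from
      inter_eq_right.2 fun t ht ↦ lt_of_lt_of_le hexp ht.1,
    integral_Icc_eq_integral_Ioc, ← integral_of_le hle]
  push_cast
  ring

/-! ## `epsTerm` in real form -/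

/-- **The `n`-th term of (sonine0) in real form**: for `φ` real, even, cut off to `[−1,1]`,
continuous there, and `y ≥ 0`,
`epsTerm φ y = (2λ/(1−λ²)) · e^{y/2}∫_{e^{−y}}^1 φ(t) η̃(e^{y}t) dt` with `λ = prolateLambda φ`,
`η̃ = cosTransform φ` — the shape `k(ρ) = ρ^{1/2}∫_{ρ⁻¹}^1 ξ(x)η(ρx)dx` of Lemma 5.2 at `ρ = e^{y}`
(`ScalingCoeffBoundaryTerms.exists_contDiff_truncScalingCoeff`) with the coefficient
`2λ/(1−λ²)` of `SeriesRemainderBounds.sonineQTerm`.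
[cite: ConnesConsani2021, Thm. 4.7 eq. (sonine0) §4 p. 18 (chunk p0018:L37–40); Lemma 5.4 proof §5 p. 20 (chunk p0020:L80–84)] -/
theorem epsTerm_eq_ofReal (heven : ∀ x, φ (-x) = φ x)
    (hsupp : ∀ x, 1 < |x| → φ x = 0) (hcont : ContinuousOn φ (Icc (-1) 1)) {y : ℝ}
    (hy : 0 ≤ y) :
    epsTerm φ y =
      ((2 * prolateLambda φ / (1 - prolateLambda φ ^ 2) *
        (Real.exp (y / 2) * ∫ t in Real.exp (-y)..1, φ t * cosTransform φ (Real.exp y * t)) :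
          ℝ) : ℂ) := by
  rw [epsTerm, scalingCoeff_prolateCutFourier_neg heven hsupp hcont hy]
  push_cast
  ring

/-- **The `n`-th term of (sonine0) in real form, for the tree's prolate functions**
(`IsProlateFunction 1 m φ`: `φ` is `C²` on `[−1,1]`, zero off `[−1,1]`, and even —
`IsProlateFunction.even`): for `y ≥ 0`,
`epsTerm φ y = (2λ/(1−λ²)) · e^{y/2}∫_{e^{−y}}^1 φ(t) η̃(e^{y}t) dt`.
[cite: ConnesConsani2021, Thm. 4.7 eq. (sonine0) §4 p. 18 (chunk p0018:L37–40); Lemma 5.4 proof §5 p. 20 (chunk p0020:L80–84)] -/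
theorem epsTerm_eq_ofReal_of_isProlateFunction {m : ℕ} (hφ : IsProlateFunction 1 m φ) {y : ℝ}
    (hy : 0 ≤ y) :
    epsTerm φ y =
      ((2 * prolateLambda φ / (1 - prolateLambda φ ^ 2) *
        (Real.exp (y / 2) * ∫ t in Real.exp (-y)..1, φ t * cosTransform φ (Real.exp y * t)) :
          ℝ) : ℂ) :=
  epsTerm_eq_ofReal hφ.even hφ.support (by simpa using hφ.contDiffOn.continuousOn) hy

/-- The route's inline spelling of the `n`-th term of the density series (items K0 `DensityRegular`,
K2 `DensitySlope` of «ConnesConsaniSemilocal») is `epsTerm` — definitional unfolding of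
`prolateLambda` and `prolateCutFourier`.
[cite: ConnesConsani2021, Thm. 4.7 eq. (sonine0) §4 p. 18] -/
theorem epsTerm_eq_routeTerm (φ : ℝ → ℝ) (x : ℝ) :
    ((((∫ v, φ v) / φ 0) / (1 - ((∫ v, φ v) / φ 0) ^ 2) : ℝ) : ℂ) *
        scalingCoeff (fun v ↦ ((φ v : ℝ) : ℂ))
          (fun v ↦ if 1 ≤ |v| then 𝓕 (fun u : ℝ ↦ ((φ u : ℝ) : ℂ)) v else 0) (-x) =
      epsTerm φ x := rfl

/-- For `x ≥ 0` the route's series `Σ'_n (term n x)` is `epsDensity ψ x`.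
[cite: ConnesConsani2021, §5 eq. (Eprime) p. 20 (chunk p0020:L107–110)] -/
theorem tsum_routeTerm_eq_epsDensity (ψ : ℕ → ℝ → ℝ) {x : ℝ} (hx : 0 ≤ x) :
    ∑' n : ℕ, ((((∫ v, ψ n v) / ψ n 0) / (1 - ((∫ v, ψ n v) / ψ n 0) ^ 2) : ℝ) : ℂ) *
        scalingCoeff (fun v ↦ ((ψ n v : ℝ) : ℂ))
          (fun v ↦ if 1 ≤ |v| then 𝓕 (fun u : ℝ ↦ ((ψ n u : ℝ) : ℂ)) v else 0) (-x) =
      epsDensity ψ x := by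
  simp only [epsTerm_eq_routeTerm, epsDensity, abs_of_nonneg hx]

end Literature.NumberTheory.ConnesConsani2021

end
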